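import Summits.ResolutionOfSingularities.ResolutionOfSingularities.Theorems.PurelyInseparableDim4PureLeafClassParity
import HarnessLib
import HarnessLib.Audit.Tags

/-!
# Purely inseparable fourfolds — the pure-leaf class over `𝔽₂` is CLOSED under every reply
# (cell res-dim4-pi; D3b (R3) of `HOME/res-dim4-p-10/D3b-PAPER.md` §2–§4: the transition table, assembled)
# [OURS · counted 0 · bookkeeping identities of OUR frame, not about resolution]

Width seat `res-dim4-p-10` (g3).  The class of the paper proof «every pure leaf wins the plain GLOBAL game over `𝔽₂`
at `q = 2`» — PRODUCT states `N(a,e) = ∏ xᵢ^{aᵢ}(1+xᵢ)^{eᵢ}` with (I5) `eᵢ` odd ⇒ `aᵢ = 0` and (I6) `aᵢ` odd,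
`eᵢ > 0` ⇒ all other `a`, `e` even; L-STATES `N(a,e)·(∏_{i∈T}(1+xᵢ) + 1)` with all `aᵢ, eᵢ` even, `aᵢ = 0` on
`T`, `|T| ≥ 2` — is closed under the cleaned transform at EVERY `𝔽₂`-rational point `b` of the relevant chart
(along-centre moves included), with the measure `Σ (aᵢ + eᵢ)` (`+ |T|`) dropping:

* **`step_singleton_classU`** — product state, centre `{x_j}` with `2 ≤ a_j`, any reply with non-zero successor:
  the successor is a product state of the class (measure `− 2`) or an L-state (measure `− 2`)
  (`step_F_of_purelyOdd` / `step_F_of_forall_even` + `classU_swap_of_purelyOdd` / `classU_swap_of_forall`);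
* **`step_pair_classU`** — product state with pure `x_j`, `x_k` (`a_j = a_k = 1`), centre `{x_j, x_k}`, chart `x_j`:
  the same with measure `− 1` (`step_F_pair_of_purelyOdd` / `step_F_pair_of_forall_even`);
* **`step_singleton_classL`** — L-state, centre `{x_j}` with `2 ≤ a_j`: a product state of the class
  (`step_F_L_exit`, measure `+ 2 = old + |T|`) or an L-state with the same bracket (`step_F_L_persist`, measure `− 2`).

Nothing here proves resolution of singularities in dimension ≥ 4 / characteristic `p`; counted 0; AI work, weaker than
expert review. bears_on: LADDER-RESOLUTION:D157-DOOR2 (res-dim4-pi · WORD #60 D3b (R3)). Supports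
stmt-ResolutionOfSingularities-16155 (helper).
-/

set_option linter.dupNamespace false

open MvPolynomial Finset

open scoped BigOperators

noncomputable section

namespace Summit.ResolutionOfSingularities.ResolutionOfSingularities.Theorems.PIDim4

namespace PureLeafNF

open Literature.AlgebraicGeometry.Resolution
open Literature.AlgebraicGeometry.Resolution.Hauser2010
open CentreBlowup PthPowerFactor

/-! ## 1. The L-bracket written two ways -/

/-- `(∏_{p i} (1+xᵢ)) − 1 = N(0, 𝟙_{p}) + 1` over `𝔽₂`. [folklore] -/
theorem prod_filter_sub_one_eq_bracket (p : Fin 4 → Prop) [DecidablePred p] :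
    (∏ i ∈ Finset.univ.filter p, (1 + X i : MvPolynomial (Fin 4) (ZMod 2))) - 1 =
      (∏ i, X i ^ (0 : ℕ) * (1 + X i) ^ (if i ∈ Finset.univ.filter p then 1 else 0) :
        MvPolynomial (Fin 4) (ZMod 2)) + 1 := by
  have hneg : (-1 : MvPolynomial (Fin 4) (ZMod 2)) = 1 := by rw [← C_1, ← C_neg]; rfl
  rw [sub_eq_add_neg, hneg, Finset.prod_filter]
  congr 1
  refine Finset.prod_congr rfl fun i _ => ?_
  rw [pow_zero, one_mul]
  by_cases hp : p i
  · rw [if_pos hp, if_pos (Finset.mem_filter.mpr ⟨Finset.mem_univ i, hp⟩), pow_one]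
  · rw [if_neg hp, if_neg (fun h => hp (Finset.mem_filter.mp h).2), pow_zero]

/-- With no odd `eᵢ` the bracket factor `(∏_{eᵢ odd}(1+xᵢ)) − 1` vanishes. [folklore] -/
theorem prod_filter_sub_one_eq_zero (e : Fin 4 → ℕ)
    (h0 : (Finset.univ.filter fun i => e i % 2 = 1).card = 0) :
    (∏ i ∈ Finset.univ.filter (fun i => e i % 2 = 1), (1 + X i : MvPolynomial (Fin 4) (ZMod 2))) - 1 = 0 := by
  rw [Finset.card_eq_zero.mp h0, Finset.prod_empty, sub_self]

/-- With exactly one odd `e_k` the bracket factor is `x_k`. [folklore] -/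
theorem prod_filter_sub_one_eq_X (e : Fin 4 → ℕ) {k : Fin 4}
    (hk : (Finset.univ.filter fun i => e i % 2 = 1) = {k}) :
    (∏ i ∈ Finset.univ.filter (fun i => e i % 2 = 1), (1 + X i : MvPolynomial (Fin 4) (ZMod 2))) - 1 = X k := by
  rw [hk, Finset.prod_singleton]; ring

/-! ## 2. The cleaning step (shared by the singleton and the pair move) -/

/-- **The three cleaning outcomes.** Let `(a′,e′)` be an exponent pair such that (i) if some `a′_k` is odd with `e′_k`
even then `(a′,e′)` is in the class, and (ii) if no such `k` exists then all `a′ᵢ` are even and, when at least two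
`e′ᵢ` are odd, `a′ᵢ = 0` at every odd `e′ᵢ` (the conclusions of `classU_swap_of_purelyOdd` / `classU_swap_of_forall`).
If `F′ ≠ 0` equals `N(a′,e′)` in case (i) and `N(a′,e′) − N(a′,ê)` in case (ii), then `F′` is a class product with
measure `≤ Σ (a′+e′)`, or a class L-state with `Σ (a₁+e₁) + |T| ≤ Σ (a′+e′)`. [folklore] -/
theorem clean_class (a' e' : Fin 4 → ℕ) (F' : MvPolynomial (Fin 4) (ZMod 2)) (hne : F' ≠ 0)
    (hαc : ∀ k, a' k % 2 = 1 → e' k % 2 = 0 →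
      (∀ i, e' i % 2 = 1 → a' i = 0) ∧
        (∀ i, a' i % 2 = 1 → 0 < e' i → ∀ i', i' ≠ i → a' i' % 2 = 0 ∧ e' i' % 2 = 0))
    (hβc : (∀ k, ¬ (a' k % 2 = 1 ∧ e' k % 2 = 0)) →
      (∀ i, a' i % 2 = 0) ∧
        (2 ≤ (Finset.univ.filter fun i => e' i % 2 = 1).card → ∀ i, e' i % 2 = 1 → a' i = 0))
    (hα : ∀ k, a' k % 2 = 1 → e' k % 2 = 0 → F' = ∏ i, X i ^ a' i * (1 + X i) ^ e' i)
    (hβ : (∀ i, a' i % 2 = 0) →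
      F' = (∏ i, X i ^ a' i * (1 + X i) ^ e' i) - ∏ i, X i ^ a' i * (1 + X i) ^ (e' i - e' i % 2)) :
    (∃ a₁ e₁ : Fin 4 → ℕ, F' = ∏ i, X i ^ a₁ i * (1 + X i) ^ e₁ i ∧
        (∀ i, e₁ i % 2 = 1 → a₁ i = 0) ∧
        (∀ i, a₁ i % 2 = 1 → 0 < e₁ i → ∀ i', i' ≠ i → a₁ i' % 2 = 0 ∧ e₁ i' % 2 = 0) ∧
        ∑ i, (a₁ i + e₁ i) ≤ ∑ i, (a' i + e' i)) ∨
    (∃ (a₁ e₁ : Fin 4 → ℕ) (T : Finset (Fin 4)), F' =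
        (∏ i, X i ^ a₁ i * (1 + X i) ^ e₁ i) *
          ((∏ i, X i ^ (0 : ℕ) * (1 + X i) ^ (if i ∈ T then 1 else 0) : MvPolynomial (Fin 4) (ZMod 2)) + 1) ∧
        (∀ i, a₁ i % 2 = 0) ∧ (∀ i, e₁ i % 2 = 0) ∧ (∀ i ∈ T, a₁ i = 0) ∧ 2 ≤ T.card ∧
        ∑ i, (a₁ i + e₁ i) + T.card ≤ ∑ i, (a' i + e' i)) := by
  by_cases hex : ∃ k, a' k % 2 = 1 ∧ e' k % 2 = 0
  · -- (α) a purely odd factor survives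
    obtain ⟨k, hak, hek⟩ := hex
    obtain ⟨h5, h6⟩ := hαc k hak hek
    exact Or.inl ⟨a', e', hα k hak hek, h5, h6, le_rfl⟩
  · -- (β) every `a′` is even
    have hno : ∀ k, ¬ (a' k % 2 = 1 ∧ e' k % 2 = 0) := fun k hk => hex ⟨k, hk⟩
    obtain ⟨hall, hT⟩ := hβc hno
    have hF' := hβ hall
    rw [prod_sub_eq_mul_L] at hF'
    have hmeas := sum_sub_mod_add_card e'
    have hsplit := Finset.sum_add_distrib (s := Finset.univ) (f := a') (g := e')
    by_cases hge : 2 ≤ (Finset.univ.filter fun i => e' i % 2 = 1).card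
    · -- an L-state is born
      refine Or.inr ⟨a', fun i => e' i - e' i % 2, Finset.univ.filter (fun i => e' i % 2 = 1), ?_, hall,
        fun i => ?_, fun i hi => hT hge i (Finset.mem_filter.mp hi).2, hge, ?_⟩
      · rw [hF', prod_filter_sub_one_eq_bracket]
      · show (e' i - e' i % 2) % 2 = 0
        omega
      · show ∑ i, (a' i + (e' i - e' i % 2)) + _ ≤ _
        rw [Finset.sum_add_distrib]
        omega
    · rw [not_le] at hge
      have h01 : (Finset.univ.filter fun i => e' i % 2 = 1).card = 0 ∨
          (Finset.univ.filter fun i => e' i % 2 = 1).card = 1 := by omega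
      rcases h01 with h0 | h1
      · -- no odd `e′`: the cleaning kills everything
        exfalso
        rw [prod_filter_sub_one_eq_zero e' h0, mul_zero] at hF'
        exact hne hF'
      · -- exactly one odd `e′_k`: the cleaning re-creates `x_k`
        obtain ⟨k, hk⟩ := Finset.card_eq_one.mp h1
        rw [prod_filter_sub_one_eq_X e' hk, X_eq_prod k, prod_mul_prod] at hF'
        obtain ⟨h5, h6⟩ := classU_add_indicator a' (fun i => e' i - e' i % 2) hall
          (fun i => by show (e' i - e' i % 2) % 2 = 0; omega) k
        refine Or.inl ⟨fun i => a' i + (if i = k then 1 else 0), fun i => (e' i - e' i % 2) + 0, hF', h5, h6, ?_⟩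
        show ∑ i, ((a' i + (if i = k then 1 else 0)) + ((e' i - e' i % 2) + 0)) ≤ _
        have hk1 : ∑ i, (if i = k then 1 else 0 : ℕ) = 1 := by
          rw [Finset.sum_ite_eq' Finset.univ k (fun _ => (1 : ℕ)), if_pos (Finset.mem_univ k)]
        simp only [add_zero]
        rw [Finset.sum_add_distrib, Finset.sum_add_distrib, hk1]
        omega

/-! ## 3. The singleton move from a product state -/

/-- **(U1) Closure under the singleton move.** Product state `N(a,e)` of the class, centre `{x_j}` with `2 ≤ a_j`,
ANY reply `b` with non-zero cleaned successor `F′`: `F′` is a product state of the class with `Σ(a₁+e₁) + 2 ≤ Σ(a+e)`,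
or an L-state of the class with `Σ(a₁+e₁) + |T| + 2 ≤ Σ(a+e)`. [OURS · counted 0] [folklore] -/
theorem step_singleton_classU (s : State (ZMod 2)) (a e : Fin 4 → ℕ)
    (hF : s.F = ∏ i, X i ^ a i * (1 + X i) ^ e i) (hI5 : ∀ i, e i % 2 = 1 → a i = 0)
    (hI6 : ∀ i, a i % 2 = 1 → 0 < e i → ∀ i', i' ≠ i → a i' % 2 = 0 ∧ e i' % 2 = 0)
    {j : Fin 4} (hj : 2 ≤ a j) (b : Fin 4 → ZMod 2) (hne : (step 2 {j} j b s).F ≠ 0) :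
    (∃ a₁ e₁ : Fin 4 → ℕ, (step 2 {j} j b s).F = ∏ i, X i ^ a₁ i * (1 + X i) ^ e₁ i ∧
        (∀ i, e₁ i % 2 = 1 → a₁ i = 0) ∧
        (∀ i, a₁ i % 2 = 1 → 0 < e₁ i → ∀ i', i' ≠ i → a₁ i' % 2 = 0 ∧ e₁ i' % 2 = 0) ∧
        ∑ i, (a₁ i + e₁ i) + 2 ≤ ∑ i, (a i + e i)) ∨
    (∃ (a₁ e₁ : Fin 4 → ℕ) (T : Finset (Fin 4)), (step 2 {j} j b s).F =
        (∏ i, X i ^ a₁ i * (1 + X i) ^ e₁ i) *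
          ((∏ i, X i ^ (0 : ℕ) * (1 + X i) ^ (if i ∈ T then 1 else 0) : MvPolynomial (Fin 4) (ZMod 2)) + 1) ∧
        (∀ i, a₁ i % 2 = 0) ∧ (∀ i, e₁ i % 2 = 0) ∧ (∀ i ∈ T, a₁ i = 0) ∧ 2 ≤ T.card ∧
        ∑ i, (a₁ i + e₁ i) + T.card + 2 ≤ ∑ i, (a i + e i)) := by
  obtain ⟨hI5', hI6'⟩ := classU_update_sub_two a e hI5 hI6 hj
  have hsum := sum_chartSwap a e hj b
  rcases clean_class (fun i => if b i = 0 then Function.update a j (a j - 2) i else e i)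
      (fun i => if b i = 0 then e i else Function.update a j (a j - 2) i) _ hne
      (fun k hak _ => classU_swap_of_purelyOdd _ e hI5' hI6' b hak)
      (fun hno => classU_swap_of_forall _ e hI5' hI6' b hno)
      (fun k hak hek => step_F_of_purelyOdd s a e hF hj b hak hek)
      (fun hall => step_F_of_forall_even s a e hF hj b hall) with
    ⟨a₁, e₁, h1, h5, h6, hm⟩ | ⟨a₁, e₁, T, h1, h2, h3, h4, h5, hm⟩
  · exact Or.inl ⟨a₁, e₁, h1, h5, h6, by omega⟩
  · exact Or.inr ⟨a₁, e₁, T, h1, h2, h3, h4, h5, by omega⟩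

/-! ## 4. The pair move from a product state -/

/-- **(U2) Closure under the pair move.** Product state `N(a,e)` of the class with `a_j = a_k = 1` (`j ≠ k`; then
`x_j`, `x_k` are pure factors), centre `{x_j, x_k}`, chart `x_j`, ANY translation `b` with non-zero cleaned successor:
a product state of the class with `Σ(a₁+e₁) + 1 ≤ Σ(a+e)`, or an L-state with `Σ(a₁+e₁) + |T| + 1 ≤ Σ(a+e)`.
[OURS · counted 0] [folklore] -/
theorem step_pair_classU (s : State (ZMod 2)) (a e : Fin 4 → ℕ)
    (hF : s.F = ∏ i, X i ^ a i * (1 + X i) ^ e i) (hI5 : ∀ i, e i % 2 = 1 → a i = 0)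
    (hI6 : ∀ i, a i % 2 = 1 → 0 < e i → ∀ i', i' ≠ i → a i' % 2 = 0 ∧ e i' % 2 = 0)
    {j k : Fin 4} (hjk : j ≠ k) (haj : a j = 1) (hak : a k = 1) (b : Fin 4 → ZMod 2)
    (hne : (step 2 {j, k} j b s).F ≠ 0) :
    (∃ a₁ e₁ : Fin 4 → ℕ, (step 2 {j, k} j b s).F = ∏ i, X i ^ a₁ i * (1 + X i) ^ e₁ i ∧
        (∀ i, e₁ i % 2 = 1 → a₁ i = 0) ∧
        (∀ i, a₁ i % 2 = 1 → 0 < e₁ i → ∀ i', i' ≠ i → a₁ i' % 2 = 0 ∧ e₁ i' % 2 = 0) ∧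
        ∑ i, (a₁ i + e₁ i) + 1 ≤ ∑ i, (a i + e i)) ∨
    (∃ (a₁ e₁ : Fin 4 → ℕ) (T : Finset (Fin 4)), (step 2 {j, k} j b s).F =
        (∏ i, X i ^ a₁ i * (1 + X i) ^ e₁ i) *
          ((∏ i, X i ^ (0 : ℕ) * (1 + X i) ^ (if i ∈ T then 1 else 0) : MvPolynomial (Fin 4) (ZMod 2)) + 1) ∧
        (∀ i, a₁ i % 2 = 0) ∧ (∀ i, e₁ i % 2 = 0) ∧ (∀ i ∈ T, a₁ i = 0) ∧ 2 ≤ T.card ∧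
        ∑ i, (a₁ i + e₁ i) + T.card + 1 ≤ ∑ i, (a i + e i)) := by
  obtain ⟨hej, hek, hI5', hI6'⟩ := classU_update_zero a e hI5 hI6 hjk haj hak
  have hsum := sum_pairSwap a e haj b
  rcases clean_class (fun i => if b i = 0 then Function.update a j 0 i else e i)
      (fun i => if b i = 0 then e i else Function.update a j 0 i) _ hne
      (fun l hal _ => classU_swap_of_purelyOdd _ e hI5' hI6' b hal)
      (fun hno => classU_swap_of_forall _ e hI5' hI6' b hno)
      (fun l hal hel => step_F_pair_of_purelyOdd s a e hF hjk haj hak hej hek b hal hel)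
      (fun hall => step_F_pair_of_forall_even s a e hF hjk haj hak hej hek b hall) with
    ⟨a₁, e₁, h1, h5, h6, hm⟩ | ⟨a₁, e₁, T, h1, h2, h3, h4, h5, hm⟩
  · exact Or.inl ⟨a₁, e₁, h1, h5, h6, by omega⟩
  · exact Or.inr ⟨a₁, e₁, T, h1, h2, h3, h4, h5, by omega⟩

/-! ## 5. The singleton move from an L-state -/

/-- **(L) Closure under the singleton move from an L-state.** `F = N(a,e)·(∏_{T}(1+xᵢ)+1)` with all exponents even
and `aᵢ = 0` on `T`, centre `{x_j}` with `2 ≤ a_j`, ANY reply `b`: if some variable of `T` is translated the successor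
is a product state of the class with `Σ(a₁+e₁) + 2 = Σ(a+e) + |T|` (`step_F_L_exit`); otherwise it is the L-state with
the same bracket and `Σ(a₁+e₁) + 2 = Σ(a+e)` (`step_F_L_persist`). [OURS · counted 0] [folklore] -/
theorem step_singleton_classL (s : State (ZMod 2)) (a e : Fin 4 → ℕ) (T : Finset (Fin 4))
    (hF : s.F = (∏ i, X i ^ a i * (1 + X i) ^ e i) *
      ((∏ i, X i ^ (0 : ℕ) * (1 + X i) ^ (if i ∈ T then 1 else 0) : MvPolynomial (Fin 4) (ZMod 2)) + 1))
    (ha : ∀ i, a i % 2 = 0) (he : ∀ i, e i % 2 = 0) (haT : ∀ i ∈ T, a i = 0) {j : Fin 4} (hj : 2 ≤ a j)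
    (b : Fin 4 → ZMod 2) :
    (∃ a₁ e₁ : Fin 4 → ℕ, (step 2 {j} j b s).F = ∏ i, X i ^ a₁ i * (1 + X i) ^ e₁ i ∧
        (∀ i, e₁ i % 2 = 1 → a₁ i = 0) ∧
        (∀ i, a₁ i % 2 = 1 → 0 < e₁ i → ∀ i', i' ≠ i → a₁ i' % 2 = 0 ∧ e₁ i' % 2 = 0) ∧
        ∑ i, (a₁ i + e₁ i) + 2 = ∑ i, (a i + e i) + T.card) ∨
    (∃ a₁ e₁ : Fin 4 → ℕ, (step 2 {j} j b s).F =
        (∏ i, X i ^ a₁ i * (1 + X i) ^ e₁ i) *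
          ((∏ i, X i ^ (0 : ℕ) * (1 + X i) ^ (if i ∈ T then 1 else 0) : MvPolynomial (Fin 4) (ZMod 2)) + 1) ∧
        (∀ i, a₁ i % 2 = 0) ∧ (∀ i, e₁ i % 2 = 0) ∧ (∀ i ∈ T, a₁ i = 0) ∧
        ∑ i, (a₁ i + e₁ i) + 2 = ∑ i, (a i + e i)) := by
  by_cases hex : ∃ k ∈ T, b k ≠ 0
  · obtain ⟨k, hkT, hbk⟩ := hex
    obtain ⟨h5, h6⟩ := classU_L_exit a e ha he T haT hj b
    exact Or.inl ⟨_, _, step_F_L_exit s a e ha he T hF hj b hkT hbk, h5, h6, sum_L_exit a e T hj b⟩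
  · push Not at hex
    obtain ⟨h1, h2, h3⟩ := classL_chartSwap a e ha he T haT hj b hex
    exact Or.inr ⟨_, _, step_F_L_persist s a e ha he T hF hj b hex, h1, h2, h3, sum_chartSwap a e hj b⟩

end PureLeafNF

end Summit.ResolutionOfSingularities.ResolutionOfSingularities.Theorems.PIDim4

end
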